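import Summits.Parity.BatemanHorn.Theorems.SoloInformedNearPrimeModuli

/-!
# The Erdős divisor-sum conjecture along `g` lives on moduli with a large smooth cofactor

Informed soloist `solo-Parity-informed` (session 146, Q32, second file), conjunct `BatemanHorn`, the `d ≥ 3` rung
BELOW the parity wall.  `SoloInformedNearPrimeModuli` proved the bilinear-localisation cost
`Mid_g(x; ⌊x^β⌋) ≤ (d·A_g·β/(1−β))·x log x + K·x` for the located root count on NEAR-PRIME moduli
(`e/P⁺(e) < ⌊x^β⌋`).  Consequently:

* **`locatedRootCountAsymptotic_iff_smoothCofactor`** — for `g` irreducible of degree `d ≥ 2`,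
  `Mid_g(x) ~ ((d−2)/2)·A_g·x log x` iff there is `L` such that for every `β ∈ (0, 1/2)` and all large `x`
  `|(Mid_g(x) − Mid_g(x; ⌊x^β⌋))/(x log x) − ((d−2)/2)·A_g| ≤ L·β`;
* **`erdosDivisorSumAsymptotic_iff_smoothCofactor`** — the same for Erdős's `∑_{n≤x} τ(|g(n)|) ~ d·A_g·x log x`
  (`erdosDivisorSumAsymptotic_iff_located`).

Reading (prose).  The conjecture is EQUIVALENT to evaluating, for each fixed `β`, the located root count over the
moduli `e ∈ (x, |g(n)|^{1/2})` whose cofactor to the largest prime factor is at least `x^β` — the moduli that admit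
a factorisation `e = m·p`, `m ≥ x^β` — to relative precision `O(β)`: "discard the near-prime moduli first" costs
`O(β)` and no more.  In particular the Fejér-positivity no-go `not_classwiseMeanProfile_largestPrimeFactor`
(`SoloInformedLargestPrimePassive`), whose witnesses are the PRIME moduli, constrains class-wise statements over all
moduli of a dyadic block and not the rung itself.  Nothing here touches a parity-blocked statement.
-/

namespace Summit.Parity.BatemanHorn.Theorems

open Finset Filter Polynomial Literature.NumberTheory.Sieve
open scoped Topology

/-- **The Erdős/located-root-count conjecture is a statement about moduli with a large smooth cofactor.**
For `g` irreducible of degree `d ≥ 2`: `Mid_g(x) ~ ((d−2)/2)·A_g·x log x` iff, for some `L` and every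
`β ∈ (0, 1/2)`, the located count over the moduli `e` with `e/P⁺(e) ≥ ⌊x^β⌋` equals `((d−2)/2)·A_g·x log x` up to
`L·β·x log x` for all large `x`. [this work] -/
theorem locatedRootCountAsymptotic_iff_smoothCofactor {g : ℤ[X]} (hirr : Irreducible g)
    (hdeg : 2 ≤ g.natDegree) :
    LocatedRootCountAsymptotic g ↔
      ∃ L : ℝ, ∀ β : ℝ, 0 < β → β < 1 / 2 →
        ∀ᶠ x : ℕ in atTop,
          |((polyLocatedRootCount g x : ℝ) - polyLocatedNearPrimeCount g x ⌊(x : ℝ) ^ β⌋₊)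
                / ((x : ℝ) * Real.log x)
              - ((g.natDegree : ℝ) - 2) / 2 * rootLevelConst g| ≤ L * β := by
  have hdeg0 : 0 < g.natDegree := by omega
  have hA0 : 0 < rootLevelConst g := rootLevelConst_pos hirr hdeg0
  set D : ℝ := (g.natDegree : ℝ) * rootLevelConst g with hD
  have hD0 : 0 ≤ D := mul_nonneg (Nat.cast_nonneg _) hA0.le
  set c : ℝ := ((g.natDegree : ℝ) - 2) / 2 * rootLevelConst g with hc
  have hlog : Tendsto (fun x : ℕ => Real.log (x : ℝ)) atTop atTop :=
    Real.tendsto_log_atTop.comp tendsto_natCast_atTop_atTop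
  -- the near-prime ratio is eventually in `[0, (2D+1)β]`
  have hr : ∀ β : ℝ, 0 < β → β < 1 / 2 → ∀ᶠ x : ℕ in atTop,
      0 ≤ (polyLocatedNearPrimeCount g x ⌊(x : ℝ) ^ β⌋₊ : ℝ) / ((x : ℝ) * Real.log x) ∧
        (polyLocatedNearPrimeCount g x ⌊(x : ℝ) ^ β⌋₊ : ℝ) / ((x : ℝ) * Real.log x) ≤ (2 * D + 1) * β := by
    intro β hβ0 hβ
    obtain ⟨K, hK⟩ := exists_polyLocatedNearPrimeCount_rpow_le hirr hdeg hβ0 (by linarith)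
    have h2 : ∀ᶠ x : ℕ in atTop, 2 ≤ x := eventually_ge_atTop 2
    have h3 : ∀ᶠ x : ℕ in atTop, K / β ≤ Real.log (x : ℝ) := hlog.eventually_ge_atTop (K / β)
    filter_upwards [h2, h3] with x hx hKx
    have hxR : (2 : ℝ) ≤ x := by exact_mod_cast hx
    have hx0 : (0 : ℝ) < x := by linarith
    have hL0 : 0 < Real.log (x : ℝ) := Real.log_pos (by linarith)
    have hxL : 0 < (x : ℝ) * Real.log x := mul_pos hx0 hL0
    refine ⟨div_nonneg (Nat.cast_nonneg _) hxL.le, ?_⟩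
    rw [div_le_iff₀ hxL]
    have h1 := hK x hx
    have hKβ : K ≤ β * Real.log (x : ℝ) := by
      have := (div_le_iff₀ hβ0).mp hKx
      linarith
    have hfrac : D * β / (1 - β) ≤ 2 * D * β := by
      rw [div_le_iff₀ (by linarith : (0 : ℝ) < 1 - β)]
      nlinarith [mul_nonneg hD0 hβ0.le]
    have hDfrac : (g.natDegree : ℝ) * rootLevelConst g * β / (1 - β) = D * β / (1 - β) := by rw [hD]
    rw [hDfrac] at h1
    nlinarith [mul_le_mul_of_nonneg_right hfrac hxL.le, mul_le_mul_of_nonneg_right hKβ hx0.le]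
  constructor
  · intro hM
    refine ⟨2 * D + 2, fun β hβ0 hβ => ?_⟩
    have hM' : ∀ᶠ x : ℕ in atTop,
        |(polyLocatedRootCount g x : ℝ) / ((x : ℝ) * Real.log x) - c| < β := by
      have := (Metric.tendsto_nhds.mp hM) β hβ0
      simpa only [Real.dist_eq] using this
    filter_upwards [hM', hr β hβ0 hβ] with x hx hrx
    have heq : ((polyLocatedRootCount g x : ℝ) - polyLocatedNearPrimeCount g x ⌊(x : ℝ) ^ β⌋₊)
          / ((x : ℝ) * Real.log x) - c
        = ((polyLocatedRootCount g x : ℝ) / ((x : ℝ) * Real.log x) - c)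
          - (polyLocatedNearPrimeCount g x ⌊(x : ℝ) ^ β⌋₊ : ℝ) / ((x : ℝ) * Real.log x) := by
      rw [sub_div]; ring
    rw [heq]
    refine (abs_sub _ _).trans ?_
    rw [abs_of_nonneg hrx.1]
    nlinarith [hrx.2, hx.le]
  · rintro ⟨L, hL⟩
    rw [LocatedRootCountAsymptotic, Metric.tendsto_nhds]
    intro ε hε
    set L' : ℝ := |L| + 2 * D + 2 with hL'
    have hL'0 : 0 < L' := by positivity
    set β : ℝ := min (1 / 4) (ε / (2 * L')) with hβ
    have hβ0 : 0 < β := lt_min (by norm_num) (by positivity)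
    have hβ : β < 1 / 2 := lt_of_le_of_lt (min_le_left _ _) (by norm_num)
    have hβε : L' * β ≤ ε / 2 := by
      have h1 : β ≤ ε / (2 * L') := min_le_right _ _
      have := mul_le_mul_of_nonneg_left h1 hL'0.le
      rw [mul_div_assoc'] at this
      calc L' * β ≤ L' * ε / (2 * L') := this
        _ = ε / 2 := by field_simp
    filter_upwards [hL β hβ0 hβ, hr β hβ0 hβ] with x hx hrx
    rw [Real.dist_eq]
    have heq : (polyLocatedRootCount g x : ℝ) / ((x : ℝ) * Real.log x) - c
        = (((polyLocatedRootCount g x : ℝ) - polyLocatedNearPrimeCount g x ⌊(x : ℝ) ^ β⌋₊)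
            / ((x : ℝ) * Real.log x) - c)
          + (polyLocatedNearPrimeCount g x ⌊(x : ℝ) ^ β⌋₊ : ℝ) / ((x : ℝ) * Real.log x) := by
      rw [sub_div]; ring
    rw [heq]
    refine lt_of_le_of_lt (abs_add_le _ _) ?_
    rw [abs_of_nonneg hrx.1]
    have hLabs : L * β ≤ |L| * β := mul_le_mul_of_nonneg_right (le_abs_self L) hβ0.le
    nlinarith [hrx.2, hx, hLabs, hβε, hε]

/-- **Erdős's asymptotic ⟺ the located count over moduli with smooth cofactor `≥ x^β`, to precision `O(β)`.**
For `g` irreducible of degree `d ≥ 2`: `∑_{n≤x} τ(|g(n)|) ~ d·A_g·x log x` iff there is `L` such that for every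
`β ∈ (0, 1/2)` and all large `x`,
`|(Mid_g(x) − Mid_g(x; ⌊x^β⌋))/(x log x) − ((d−2)/2)·A_g| ≤ L·β`.  "Discard the near-prime moduli first" is a
reduction with price `O(β)`. [this work] -/
theorem erdosDivisorSumAsymptotic_iff_smoothCofactor {g : ℤ[X]} (hirr : Irreducible g)
    (hdeg : 2 ≤ g.natDegree) :
    ErdosDivisorSumAsymptotic g ↔
      ∃ L : ℝ, ∀ β : ℝ, 0 < β → β < 1 / 2 →
        ∀ᶠ x : ℕ in atTop,
          |((polyLocatedRootCount g x : ℝ) - polyLocatedNearPrimeCount g x ⌊(x : ℝ) ^ β⌋₊)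
                / ((x : ℝ) * Real.log x)
              - ((g.natDegree : ℝ) - 2) / 2 * rootLevelConst g| ≤ L * β :=
  (erdosDivisorSumAsymptotic_iff_located hirr hdeg).trans (locatedRootCountAsymptotic_iff_smoothCofactor hirr hdeg)

end Summit.Parity.BatemanHorn.Theorems
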